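import Mathlib
import Literature.AlgebraicGeometry.Resolution.QuasiProjectiveResolution
import Literature.AlgebraicGeometry.Resolution.ResolutionLocalization
import Literature.AlgebraicGeometry.Resolution.ResolutionGlue

/-!
# Crux `PicoverLocalModel` (stmt-ResolutionOfSingularities-0557), line `SketchIdeator3`
# (giraud-cossart-normal-form) — stub `stub_modificationTransfer`

**Resolutions transfer down a proper birational base change.** Let `f : X → Y` be a dominant
morphism of integral schemes and `π : W → Y` proper birational. If the fibre product `X ×_Y W` is
integral and has a (weak) resolution of singularities, then so does `X`:

* the projection `ρ : X ×_Y W → X` is proper (base change of `π`);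
* it is birational: if `π` is an isomorphism over the dense open `U ⊆ Y`, then `ρ` is an
  isomorphism over `V := f⁻¹ U` (base change of an isomorphism over an open,
  `Literature.AlgebraicGeometry.Morphisms.isIso_morphismRestrict_pullback_fst`); `V` is non-empty
  because `f` is dominant, hence dense in the irreducible `X`; and `ρ⁻¹ V ≅ V` is a non-empty open
  of the irreducible `X ×_Y W`, hence dense;
* proper birational morphisms transport resolutions (`Scheme.HasResolution.of_isBirational`).

Everything here is folklore bookkeeping around Mathlib's scheme library.
-/

noncomputable section

-- single-problem summit: the doubled namespace component `ResolutionOfSingularities` is the tree layout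
set_option linter.dupNamespace false

open CategoryTheory CategoryTheory.Limits AlgebraicGeometry TopologicalSpace
open Literature.AlgebraicGeometry.Resolution

namespace Summit.ResolutionOfSingularities.ResolutionOfSingularities.Theorems.PicoverLocalModel.ModificationTransfer

/-- **The base change of a birational morphism along a dominant morphism is birational**, as soon
as the fibre product is irreducible: if `π : W → Y` is an isomorphism over the dense open `U`,
then `X ×_Y W → X` is an isomorphism over `f⁻¹ U`, which is non-empty (dominance) hence dense in
the irreducible `X`, and whose preimage `≅ f⁻¹ U` is a non-empty open of the irreducible
`X ×_Y W`. [folklore] -/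
theorem isBirational_pullback_fst {X Y W : Scheme.{0}} [IrreducibleSpace X] (f : X ⟶ Y)
    [IsDominant f] (π : W ⟶ Y) (hπ : IsBirational π) [IrreducibleSpace ↑(pullback f π)] :
    IsBirational (pullback.fst f π) := by
  obtain ⟨U, hU, -, hiso⟩ := hπ
  haveI := hiso
  haveI hisoV : IsIso (pullback.fst f π ∣_ f ⁻¹ᵁ U) :=
    Literature.AlgebraicGeometry.Morphisms.isIso_morphismRestrict_pullback_fst f π U
  -- `f⁻¹ U` is a non-empty open of the irreducible `X`
  haveI : Nonempty Y := Nonempty.map f inferInstance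
  obtain ⟨x, hx⟩ : ∃ x : X, f x ∈ (U : Set Y) :=
    f.denseRange.exists_mem_open U.2 hU.nonempty
  have hVd : Dense ((f ⁻¹ᵁ U : X.Opens) : Set X) := (f ⁻¹ᵁ U).2.dense ⟨x, hx⟩
  -- its preimage `≅ f⁻¹ U` is a non-empty open of the irreducible `X ×_Y W`
  have hPd : Dense ((pullback.fst f π ⁻¹ᵁ f ⁻¹ᵁ U : (pullback f π).Opens) : Set ↑(pullback f π)) := by
    obtain ⟨z, hz⟩ := (Scheme.homeoOfIso (asIso (pullback.fst f π ∣_ f ⁻¹ᵁ U))).symm ⟨x, hx⟩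
    exact (pullback.fst f π ⁻¹ᵁ f ⁻¹ᵁ U).2.dense ⟨z, hz⟩
  exact ⟨f ⁻¹ᵁ U, hVd, hPd, hisoV⟩

/-- **Resolutions transfer down a proper birational base change** (registered stub
`stub_modificationTransfer` of the line `SketchIdeator3` of crux
stmt-ResolutionOfSingularities-0557). Let `f : X → Y` be a dominant morphism of integral schemes
and `π : W → Y` proper birational; if `X ×_Y W` is integral and has a resolution, then `X` has a
resolution: `X ×_Y W → X` is proper (base change) and birational (`isBirational_pullback_fst`),
and proper birational morphisms transport resolutions (`Scheme.HasResolution.of_isBirational`).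
[folklore] -/
theorem stub_modificationTransfer : ∀ (X Y W : Scheme.{0}) [IsIntegral X] [IsIntegral Y]
    [IsIntegral W] (f : X ⟶ Y) [IsDominant f] (π : W ⟶ Y) [IsProper π], IsBirational π →
    IsIntegral (pullback f π) → Scheme.HasResolution (pullback f π) → Scheme.HasResolution X := by
  intro X Y W _ _ _ f _ π _ hπ hint hres
  haveI := hint
  exact Scheme.HasResolution.of_isBirational (pullback.fst f π) (isBirational_pullback_fst f π hπ)
    hres

end Summit.ResolutionOfSingularities.ResolutionOfSingularities.Theorems.PicoverLocalModel.ModificationTransfer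

end
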